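import Summits.BirchSwinnertonDyer.BirchSwinnertonDyer.Theorems.ResidualThetaTransportAtTwoThetaLayerLambdaCongruenceAtTwoDoubling
import Literature.NumberTheory.EllipticCurves.HasseWeilGoodReductionFrobenius
import Literature.NumberTheory.EllipticCurves.IsogenyFrobeniusTraceProofs
import Literature.NumberTheory.EllipticCurves.ModularityVersionApProofs
import Literature.NumberTheory.GaloisRepresentations.ArtinDirichletCoefficients
import Literature.NumberTheory.EllipticCurves.Rank1Residual.Predicates
import Literature.NumberTheory.Automorphic.Sweep1
import HarnessLib

/-!
# Crux `ThetaLayerLambdaCongruenceAtTwo` (stmt-BirchSwinnertonDyer-20688, route ResidualThetaTransportAtTwo), line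
# `birth`: `S₀`-MONOTONICITY of the integral congruence (H♮) — it suffices to prove (H♮) for the MINIMAL admissible
# depletion set `S₀ = bad(W) ∪ primes(M)` (width prover bsd-wall-rtt-p3-w2 g0; `--supports stmt-BirchSwinnertonDyer-20688
# --as helper`; closes nothing)

HONEST FRAMING. THEOREMS ONLY; the research input (H♮ on minimal `S₀`) is an explicit hypothesis spelled inline;
nothing about any curve or form is asserted; BSD is not proved by any of this.

WHAT. Stub (H♮) `stub_depletedLayerCongruenceTwo` of skeleton v4 (sha16 2c76043589650c55) asks, for EVERY admissible
`S₀` (odd places containing the bad places of `W` and the primes of `M`), at a cohomological period and for large even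
`n`, for a scalar `a` with `‖C a·Θ^{S₀}_n(W) − Θ^{S₀}_n(g;Ω)‖_sup < ‖2‖₂`. THIS FILE: (H♮) for the MINIMAL admissible set
already gives (H♮) for all of them (`stub_depletedLayerCongruenceTwo_of_minimal`), with the SAME `a` and the SAME `n₀`.
Reason (§1–§2): an admissible `S₁` is `S₀ ⊔ T` with `S₀ = {v ∈ S₁ : v bad or ℓ_v ∣ M}` minimal admissible and `T` made
of GOOD places `v` with `ℓ_v ∤ 2M`; for `v ∈ T` the two Euler polynomials are `1 − a_ℓ(W)X + ℓX²`
(`localPolynomialAt_of_hasGoodReductionAt`, `q_v = ℓ_v`) and `1 − ι a_ℓ(g) X + ℓ X²`, congruent coefficientwise by the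
crux's `hcong` (`ℓ ∤ 2·M·N_W` as `ℓ ∤ N_W ⟺` good, `dvd_conductorNorm_iff`), so the extra depletion factors `E_W`, `E_g`
are integral with `‖E_W − E_g‖_sup < 1`; and since `Θ^{S₁} = (Θ^{S₀}·E) mod ω_n` on each side,
`C a·Θ^{S₁}_W − Θ^{S₁}_g ≡ (C a·Θ^{S₀}_W − Θ^{S₀}_g)·E_W + Θ^{S₀}_g·(E_W − E_g) (mod ω_n)` has sup norm
`< max(‖2‖·1, ‖2‖·1) = ‖2‖` (ultrametric; `‖Θ^{S₀}_g‖_sup ≤ ‖2‖₂` by the `Δ`-doubling, `supNorm_depletedPartnerLayer_le`;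
reduction modulo the integral monic `ω_n` does not increase the sup norm). So the research content of (H♮) is the
single congruence at `S₀ = bad(W) ∪ primes(M)` — Greenberg–Vatsal's `Σ₀` (§1, display (10)).

References: [GreenbergVatsal2000] §1 (display (8)–(10)), Prop. (2.4); [DiamondShurman2005] §8.3 (`p ∣ N_E` iff bad);
[SilvermanAEC2009] C.§16 (`L_v = 1 − a_v T + q_v T²`).
-/

noncomputable section

-- justification: the `Summit.BirchSwinnertonDyer.BirchSwinnertonDyer.…` path repeats a component (route-file convention)
set_option linter.dupNamespace false

open scoped Classical

open Polynomial

open Literature.NumberTheory.IwasawaTheory Literature.NumberTheory.EllipticCurves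
  Literature.NumberTheory.EllipticCurves.ModularForms

namespace Summit.BirchSwinnertonDyer.BirchSwinnertonDyer.Theorems.ThetaLayerLambdaCongruenceAtTwo

/-! ## §1. Ultrametric algebra: extra integral, congruent factors preserve a congruence of level `c` -/

section Algebra

variable {K : Type*} [Field K]

/-- `((A mod ω)·B) mod ω = (A·B) mod ω` for a monic `ω`. [folklore] -/
theorem modByMonic_mul_modByMonic {ω : K[X]} (hω : ω.Monic) (A B : K[X]) :
    (A %ₘ ω * B) %ₘ ω = (A * B) %ₘ ω := by
  refine modByMonic_eq_of_dvd_sub hω ⟨-(A /ₘ ω * B), ?_⟩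
  have h := modByMonic_add_div A ω
  linear_combination B * h

end Algebra

section Estimate

variable {K : Type*} [NormedField K] [IsUltrametricDist K]

omit [IsUltrametricDist K] in
/-- `(C c · p) mod q = C c · (p mod q)`. [folklore] -/
theorem C_mul_modByMonic' (c : K) (p q : K[X]) : (C c * p) %ₘ q = C c * (p %ₘ q) := by
  rw [C_mul', C_mul', smul_modByMonic]

/-- In an ultrametric normed field, products of integral factors that are congruent factor by factor are congruent:
`‖A_v‖, ‖B_v‖ ≤ 1` and `‖A_v − B_v‖ < 1` for all `v ∈ T` give `‖∏ A_v − ∏ B_v‖_sup < 1`. [folklore] -/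
theorem supNorm_prod_sub_prod_lt_one {α : Type*} (T : Finset α) (A B : α → K[X])
    (hA : ∀ v ∈ T, (A v).supNorm ≤ 1) (hB : ∀ v ∈ T, (B v).supNorm ≤ 1)
    (hAB : ∀ v ∈ T, (A v - B v).supNorm < 1) :
    (∏ v ∈ T, A v - ∏ v ∈ T, B v).supNorm < 1 := by
  classical
  induction T using Finset.induction_on with
  | empty => simp [supNorm_zero]
  | insert a s ha ih =>
    rw [Finset.prod_insert ha, Finset.prod_insert ha]
    have e : A a * ∏ v ∈ s, A v - B a * ∏ v ∈ s, B v =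
        (A a - B a) * ∏ v ∈ s, A v + B a * (∏ v ∈ s, A v - ∏ v ∈ s, B v) := by ring
    rw [e]
    refine (supNorm_add_le_max _ _).trans_lt (max_lt ?_ ?_)
    · rw [supNorm_mul']
      exact mul_lt_one_of_nonneg_of_lt_one_left (supNorm_nonneg _) (hAB a (Finset.mem_insert_self a s))
        (supNorm_prod_le_one _ _ fun v hv ↦ hA v (Finset.mem_insert_of_mem hv))
    · rw [supNorm_mul']
      exact mul_lt_one_of_nonneg_of_lt_one_right (hB a (Finset.mem_insert_self a s)) (supNorm_nonneg _)
        (ih (fun v hv ↦ hA v (Finset.mem_insert_of_mem hv)) (fun v hv ↦ hB v (Finset.mem_insert_of_mem hv))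
          fun v hv ↦ hAB v (Finset.mem_insert_of_mem hv))


/-- **The monotonicity estimate.** Let `ω` be monic with integral coefficients, `P, Q ∈ K[X]` with
`‖C a·(P mod ω) − (Q mod ω)‖_sup < c` and `‖Q mod ω‖_sup ≤ c`, and `E, E'` with `‖E‖_sup ≤ 1`, `‖E − E'‖_sup < 1`. Then
`‖C a·((P·E) mod ω) − (Q·E') mod ω‖_sup < c`, because modulo `ω`,
`C a·P·E − Q·E' ≡ (C a·(P mod ω) − Q mod ω)·E + (Q mod ω)·(E − E')`. [folklore] -/
theorem supNorm_congr_mul_modByMonic_lt {ω : K[X]} (hω : ω.Monic) (hω1 : ω.supNorm ≤ 1) {P Q E E' : K[X]}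
    {a : K} {c : ℝ} (hc : 0 < c) (hPQ : (C a * (P %ₘ ω) - Q %ₘ ω).supNorm < c) (hQ : (Q %ₘ ω).supNorm ≤ c)
    (hE : E.supNorm ≤ 1) (hEE : (E - E').supNorm < 1) :
    (C a * ((P * E) %ₘ ω) - (Q * E') %ₘ ω).supNorm < c := by
  have hP' := modByMonic_add_div P ω
  have hQ' := modByMonic_add_div Q ω
  have hdvd : ω ∣ (C a * (P * E) - Q * E') - ((C a * (P %ₘ ω) - Q %ₘ ω) * E + Q %ₘ ω * (E - E')) :=
    ⟨C a * (P /ₘ ω) * E - (Q /ₘ ω) * E', by linear_combination (-(C a * E)) * hP' + E' * hQ'⟩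
  rw [← C_mul_modByMonic', ← sub_modByMonic, modByMonic_eq_of_dvd_sub hω hdvd, add_modByMonic]
  refine (supNorm_add_le_max _ _).trans_lt (max_lt ?_ ?_)
  · refine (supNorm_modByMonic_le hω hω1 _).trans_lt ?_
    rw [supNorm_mul']
    calc (C a * (P %ₘ ω) - Q %ₘ ω).supNorm * E.supNorm ≤ (C a * (P %ₘ ω) - Q %ₘ ω).supNorm * 1 :=
          mul_le_mul_of_nonneg_left hE (supNorm_nonneg _)
      _ < c := by rw [mul_one]; exact hPQ
  · refine (supNorm_modByMonic_le hω hω1 _).trans_lt ?_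
    rw [supNorm_mul']
    calc (Q %ₘ ω).supNorm * (E - E').supNorm ≤ c * (E - E').supNorm :=
          mul_le_mul_of_nonneg_right hQ (supNorm_nonneg _)
      _ < c * 1 := mul_lt_mul_of_pos_left hEE hc
      _ = c := mul_one c

end Estimate

/-! ## §2. The extra Euler factors at good places off `2M` are integral and congruent -/

section Euler

/-- `‖z‖ ≤ 1` for an integer `z` in `ℚ̄_p` (private helper). [folklore] -/
private theorem norm_intCast_padicAlgCl_le_one {p : ℕ} [Fact p.Prime] (z : ℤ) : ‖(z : PadicAlgCl p)‖ ≤ 1 := by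
  rw [← map_intCast (algebraMap ℚ_[p] (PadicAlgCl p)) z]
  change ‖((z : ℚ_[p]) : PadicAlgCl p)‖ ≤ 1
  rw [PadicAlgCl.norm_extends]
  exact Padic.norm_int_le_one z

variable {W : WeierstrassCurve ℚ} [W.IsElliptic] [W.IsGloballyMinimal]

/-- At a GOOD place `v` of `W` the tree's Euler polynomial is `1 − a_ℓ(W) X + ℓ X²` with `ℓ = ℓ_v` and
`a_ℓ(W) = W.frobeniusTrace ℓ` (`localPolynomialAt_of_hasGoodReductionAt`, `q_v = N v = ℓ_v`,
`frobeniusTraceAt_eq_frobeniusTrace`). [cite: SilvermanAEC2009, C.§16] -/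
theorem localPolynomialAt_eq_of_good {v : IsDedekindDomain.HeightOneSpectrum (NumberField.RingOfIntegers ℚ)}
    (hv : W.HasGoodReductionAt v) :
    W.localPolynomialAt v = 1 - C (W.frobeniusTrace (Rat.HeightOneSpectrum.natGenerator v)) * X +
      C (Rat.HeightOneSpectrum.natGenerator v : ℤ) * X ^ 2 := by
  rw [WeierstrassCurve.localPolynomialAt_of_hasGoodReductionAt hv, WeierstrassCurve.natCard_residueField_eq_residueCard,
    Literature.NumberTheory.GaloisRepresentations.Rat.residueCard_eq_natGenerator',
    WeierstrassCurve.frobeniusTraceAt_eq_frobeniusTrace W v]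
  rfl

omit [W.IsGloballyMinimal] in
/-- A good place `v` of `W` with `ℓ_v` odd and `ℓ_v ∤ M` has `ℓ_v ∤ 2·M·N_W` (`ℓ_v ∣ N_W ⟺ v` bad, `dvd_conductorNorm_iff`).
[cite: DiamondShurman2005, §8.3 (p ∣ N_E iff bad reduction)] -/
theorem not_dvd_two_mul_level_mul_conductor {v : IsDedekindDomain.HeightOneSpectrum (NumberField.RingOfIntegers ℚ)}
    (hv : W.HasGoodReductionAt v) (h2 : ¬ 2 ∣ Rat.HeightOneSpectrum.natGenerator v) {M : ℕ}
    (hM : ¬ Rat.HeightOneSpectrum.natGenerator v ∣ M) :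
    ¬ Rat.HeightOneSpectrum.natGenerator v ∣ 2 * M * W.conductorNorm ℤ := by
  have hp := Rat.HeightOneSpectrum.prime_natGenerator v
  intro h
  rcases (Nat.Prime.dvd_mul hp).mp h with h1 | h1
  · rcases (Nat.Prime.dvd_mul hp).mp h1 with h3 | h3
    · exact h2 (((Nat.prime_dvd_prime_iff_eq hp Nat.prime_two).mp h3) ▸ dvd_rfl)
    · exact hM h3
  · exact ((WeierstrassCurve.dvd_conductorNorm_iff W v).mp h1) hv

variable {M : ℕ} {g : CuspForm (CongruenceSubgroup.Gamma0 M) 2} (ι : coeffField g →+* PadicAlgCl 2)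

/-- **The extra depletion factors are congruent.** At a good place `v` of `W` with `ℓ = ℓ_v` odd, `ℓ ∤ M` and
`‖ι a_ℓ(g) − a_ℓ(W)‖ < 1`, the curve's factor `L_v(W,X) ∘ (ℓ⁻¹(1+X)^e)` and the partner's factor
`(1 − ι a_ℓ(g) X + 𝟙_{ℓ∤M} ℓ X²) ∘ (ℓ⁻¹(1+X)^e)` differ by `(ι a_ℓ(g) − a_ℓ(W))·ℓ⁻¹(1+X)^e`, of sup norm `< 1`.
[cite: GreenbergVatsal2000, §1 (display (10)) and Prop. (2.4)] -/
theorem supNorm_eulerFactor_sub_partnerEulerFactor_lt_one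
    {v : IsDedekindDomain.HeightOneSpectrum (NumberField.RingOfIntegers ℚ)} (hv : W.HasGoodReductionAt v)
    (h2 : ¬ 2 ∣ Rat.HeightOneSpectrum.natGenerator v) (hM : ¬ Rat.HeightOneSpectrum.natGenerator v ∣ M)
    (hcong : ‖embCoeff g ι (Rat.HeightOneSpectrum.natGenerator v) -
      (W.frobeniusTrace (Rat.HeightOneSpectrum.natGenerator v) : PadicAlgCl 2)‖ < 1) (n : ℕ) :
    (((W.localPolynomialAt v).map (Int.castRingHom (PadicAlgCl 2))).comp (Polynomial.C ((Rat.HeightOneSpectrum.natGenerator v : PadicAlgCl 2)⁻¹) * (Polynomial.X + 1) ^ (PadicInt.toZModPow n (-(Literature.NumberTheory.EllipticCurves.GreenbergVatsal2000.frobeniusExponent 2 (Rat.HeightOneSpectrum.natGenerator v : ℤ_[2])))).val) -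
      (1 - Polynomial.C (Literature.NumberTheory.EllipticCurves.embCoeff g ι (Rat.HeightOneSpectrum.natGenerator v)) * Polynomial.X + (if Rat.HeightOneSpectrum.natGenerator v ∣ M then 0 else Polynomial.C (Rat.HeightOneSpectrum.natGenerator v : PadicAlgCl 2)) * Polynomial.X ^ 2).comp (Polynomial.C ((Rat.HeightOneSpectrum.natGenerator v : PadicAlgCl 2)⁻¹) * (Polynomial.X + 1) ^ (PadicInt.toZModPow n (-(Literature.NumberTheory.EllipticCurves.GreenbergVatsal2000.frobeniusExponent 2 (Rat.HeightOneSpectrum.natGenerator v : ℤ_[2])))).val)).supNorm < 1 := by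
  have hℓ1 : ‖(Rat.HeightOneSpectrum.natGenerator v : PadicAlgCl 2)‖ = 1 := norm_natCast_padicAlgCl_two_eq_one h2
  rw [localPolynomialAt_eq_of_good hv, if_neg hM, ← sub_comp]
  have e : ((1 - C (W.frobeniusTrace (Rat.HeightOneSpectrum.natGenerator v)) * X +
      C (Rat.HeightOneSpectrum.natGenerator v : ℤ) * X ^ 2 : ℤ[X]).map (Int.castRingHom (PadicAlgCl 2)) -
      (1 - C (embCoeff g ι (Rat.HeightOneSpectrum.natGenerator v)) * X +
        C (Rat.HeightOneSpectrum.natGenerator v : PadicAlgCl 2) * X ^ 2)) =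
      C (embCoeff g ι (Rat.HeightOneSpectrum.natGenerator v) -
        (W.frobeniusTrace (Rat.HeightOneSpectrum.natGenerator v) : PadicAlgCl 2)) * X := by
    simp only [Polynomial.map_add, Polynomial.map_sub, Polynomial.map_mul, Polynomial.map_pow, Polynomial.map_one,
      Polynomial.map_X, Polynomial.map_C]
    simp only [eq_intCast, Int.cast_natCast, map_sub]
    ring
  rw [e, mul_comp, C_comp, X_comp, supNorm_mul', supNorm_C, supNorm_C_mul, norm_inv, hℓ1, inv_one, one_mul,
    supNorm_pow']
  have hX1 : ((X + 1 : (PadicAlgCl 2)[X])).supNorm ≤ 1 :=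
    (supNorm_add_le_max _ _).trans (max_le (by rw [supNorm_X]) (by rw [← C_1, supNorm_C, norm_one]))
  exact mul_lt_one_of_nonneg_of_lt_one_left (norm_nonneg _) hcong (pow_le_one₀ (supNorm_nonneg _) hX1)

omit [W.IsElliptic] [W.IsGloballyMinimal] in
/-- The curve's Euler factor `L_v(W,X) ∘ (ℓ_v⁻¹(1+X)^e)` at an odd place is integral (`L_v ∈ ℤ[X]`, `‖ℓ_v⁻¹‖₂ = 1`).
[cite: GreenbergVatsal2000, §1 (display (8))] -/
theorem supNorm_eulerFactor_le_one {v : IsDedekindDomain.HeightOneSpectrum (NumberField.RingOfIntegers ℚ)}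
    (h2 : ¬ 2 ∣ Rat.HeightOneSpectrum.natGenerator v) (n : ℕ) :
    (((W.localPolynomialAt v).map (Int.castRingHom (PadicAlgCl 2))).comp (Polynomial.C ((Rat.HeightOneSpectrum.natGenerator v : PadicAlgCl 2)⁻¹) * (Polynomial.X + 1) ^ (PadicInt.toZModPow n (-(Literature.NumberTheory.EllipticCurves.GreenbergVatsal2000.frobeniusExponent 2 (Rat.HeightOneSpectrum.natGenerator v : ℤ_[2])))).val)).supNorm ≤ 1 := by
  have hℓ1 : ‖(Rat.HeightOneSpectrum.natGenerator v : PadicAlgCl 2)‖ = 1 := norm_natCast_padicAlgCl_two_eq_one h2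
  have hX1 : ((X + 1 : (PadicAlgCl 2)[X])).supNorm ≤ 1 :=
    (supNorm_add_le_max _ _).trans (max_le (by rw [supNorm_X]) (by rw [← C_1, supNorm_C, norm_one]))
  apply supNorm_comp_le_one
  · refine supNorm_le_of_forall_coeff_le fun j ↦ ?_
    rw [coeff_map, eq_intCast]
    exact norm_intCast_padicAlgCl_le_one _
  · rw [supNorm_C_mul, norm_inv, hℓ1, inv_one, one_mul, supNorm_pow']
    exact pow_le_one₀ (supNorm_nonneg _) hX1

end Euler

/-! ## §3. (H♮) for the minimal admissible `S₀` gives (H♮) for every admissible `S₀` -/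

/-- **`S₀`-monotonicity of the integral congruence (H♮).** If the stub (H♮) `stub_depletedLayerCongruenceTwo` of
line `birth` (skeleton v4) holds for the MINIMAL admissible depletion sets — those `S₀` all of whose places are bad for
`W` or divide the partner's level `M` (extra hypothesis `∀ v ∈ S₀, ¬ W.HasGoodReductionAt v ∨ ℓ_v ∣ M`) — then it holds
VERBATIM (for every admissible `S₀`), with the same scalar `a` and the same `n₀`: split `S₁ = S₀ ⊔ T` with `S₀` the
minimal part; the extra factors over `T` (good places with `ℓ ∤ 2M`) are integral and congruent by `hcong`
(`supNorm_eulerFactor_sub_partnerEulerFactor_lt_one`), and the estimate `supNorm_congr_mul_modByMonic_lt` at level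
`c = ‖2‖₂` (using `‖Θ^{S₀}_n(g;Ω)‖_sup ≤ ‖2‖₂`, `supNorm_depletedPartnerLayer_le`) transports the congruence.
[cite: GreenbergVatsal2000, §1 (display (10)) and Prop. (2.4)] -/
theorem stub_depletedLayerCongruenceTwo_of_minimal
    (hHmin : ∀ (W : WeierstrassCurve ℚ) [W.IsElliptic] [W.IsGloballyMinimal], ¬ W.HasCM → W.analyticRank = 0 → Literature.NumberTheory.EllipticCurves.Rank1Residual.GoodSS W 2 → W.frobeniusTrace 2 = 0 → W.Δ < 0 → ∀ (M : ℕ) [NeZero M] (g : CuspForm (CongruenceSubgroup.Gamma0 M) 2) (ι : Literature.NumberTheory.EllipticCurves.ModularForms.coeffField g →+* PadicAlgCl 2) (Ω : ℂ), Odd M → Literature.NumberTheory.EllipticCurves.ModularForms.IsNewform0 g → Literature.NumberTheory.Automorphic.IsCMForm (Literature.NumberTheory.EllipticCurves.ModularForms.liftToGamma1 M 2 g) → Literature.NumberTheory.EllipticCurves.ModularForms.cuspCoeff g 2 = 0 → Literature.NumberTheory.EllipticCurves.IsCohomologicalPlusPeriod g ι Ω → (∀ ℓ : ℕ, ℓ.Prime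 → ¬ ℓ ∣ 2 * M * W.conductorNorm ℤ → ‖Literature.NumberTheory.EllipticCurves.embCoeff g ι ℓ - (W.frobeniusTrace ℓ : PadicAlgCl 2)‖ < 1) → ∀ [NeZero (W.conductorNorm ℤ)] (f : CuspForm (CongruenceSubgroup.Gamma0 (W.conductorNorm ℤ)) 2), Literature.NumberTheory.EllipticCurves.ModularForms.IsNewformOf W f → ∀ (S₀ : Finset (IsDedekindDomain.HeightOneSpectrum (NumberField.RingOfIntegers ℚ))), (∀ v ∈ S₀, ((2 : ℕ) : NumberField.RingOfIntegers ℚ) ∉ v.asIdeal) → (∀ v : IsDedekindDomain.HeightOneSpectrum (NumberField.RingOfIntegers ℚ), ¬ W.HasGoodReductionAt v → v ∈ S₀) → (∀ v : IsDedekindDomain.HeightOneSpectrum (NumberField.RingOfIntegers ℚ), Rat.HeightOneSpectrum.natGenerator v ∣ M → v ∈ S₀) → (∀ v ∈ S₀, ¬ W.HasGoodReductionAt v ∨ Rat.HeightOneSpectrum.natGenerator v ∣ M) → ∃ n₀ : ℕ, ∀ n ≥ n₀, Even n → ∃ a : PadicAlgCl 2, (Polynomial.C a * (((Literature.NumberTheory.EllipticCurves.mazurTateElement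 f 2 n).map (algebraMap ℚ (PadicAlgCl 2)) * ∏ v ∈ S₀, ((W.localPolynomialAt v).map (Int.castRingHom (PadicAlgCl 2))).comp (Polynomial.C ((Rat.HeightOneSpectrum.natGenerator v : PadicAlgCl 2)⁻¹) * (Polynomial.X + 1) ^ (PadicInt.toZModPow n (-(Literature.NumberTheory.EllipticCurves.GreenbergVatsal2000.frobeniusExponent 2 (Rat.HeightOneSpectrum.natGenerator v : ℤ_[2])))).val)) %ₘ ((Polynomial.X + 1) ^ 2 ^ n - 1)) - (((Literature.NumberTheory.EllipticCurves.mazurTateElementK g Ω 2 n).map ι * ∏ v ∈ S₀, (1 - Polynomial.C (Literature.NumberTheory.EllipticCurves.embCoeff g ι (Rat.HeightOneSpectrum.natGenerator v)) * Polynomial.X + (if Rat.HeightOneSpectrum.natGenerator v ∣ M then 0 else Polynomial.C (Rat.HeightOneSpectrum.natGenerator v : PadicAlgCl 2)) * Polynomial.X ^ 2).comp (Polynomial.C ((Rat.HeightOneSpectrum.natGenerator v : PadicAlgCl 2)⁻¹) * (Polynomial.X + 1) ^ (PadicInt.toZModPow n (-(Literature.NumberTheory.EllipticCurves.GreenbergVatsal2000.frobeniusExponent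 2 (Rat.HeightOneSpectrum.natGenerator v : ℤ_[2])))).val)) %ₘ ((Polynomial.X + 1) ^ 2 ^ n - 1))).supNorm < ‖(2 : PadicAlgCl 2)‖) :
    ∀ (W : WeierstrassCurve ℚ) [W.IsElliptic] [W.IsGloballyMinimal], ¬ W.HasCM → W.analyticRank = 0 → Literature.NumberTheory.EllipticCurves.Rank1Residual.GoodSS W 2 → W.frobeniusTrace 2 = 0 → W.Δ < 0 → ∀ (M : ℕ) [NeZero M] (g : CuspForm (CongruenceSubgroup.Gamma0 M) 2) (ι : Literature.NumberTheory.EllipticCurves.ModularForms.coeffField g →+* PadicAlgCl 2) (Ω : ℂ), Odd M → Literature.NumberTheory.EllipticCurves.ModularForms.IsNewform0 g → Literature.NumberTheory.Automorphic.IsCMForm (Literature.NumberTheory.EllipticCurves.ModularForms.liftToGamma1 M 2 g) → Literature.NumberTheory.EllipticCurves.ModularForms.cuspCoeff g 2 = 0 → Literature.NumberTheory.EllipticCurves.IsCohomologicalPlusPeriod g ι Ω → (∀ ℓ : ℕ, ℓ.Prime → ¬ ℓ ∣ 2 * M * W.conductorNorm ℤ → ‖Literature.NumberTheory.EllipticCurves.embCoeff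 g ι ℓ - (W.frobeniusTrace ℓ : PadicAlgCl 2)‖ < 1) → ∀ [NeZero (W.conductorNorm ℤ)] (f : CuspForm (CongruenceSubgroup.Gamma0 (W.conductorNorm ℤ)) 2), Literature.NumberTheory.EllipticCurves.ModularForms.IsNewformOf W f → ∀ (S₀ : Finset (IsDedekindDomain.HeightOneSpectrum (NumberField.RingOfIntegers ℚ))), (∀ v ∈ S₀, ((2 : ℕ) : NumberField.RingOfIntegers ℚ) ∉ v.asIdeal) → (∀ v : IsDedekindDomain.HeightOneSpectrum (NumberField.RingOfIntegers ℚ), ¬ W.HasGoodReductionAt v → v ∈ S₀) → (∀ v : IsDedekindDomain.HeightOneSpectrum (NumberField.RingOfIntegers ℚ), Rat.HeightOneSpectrum.natGenerator v ∣ M → v ∈ S₀) → ∃ n₀ : ℕ, ∀ n ≥ n₀, Even n → ∃ a : PadicAlgCl 2, (Polynomial.C a * (((Literature.NumberTheory.EllipticCurves.mazurTateElement f 2 n).map (algebraMap ℚ (PadicAlgCl 2)) * ∏ v ∈ S₀, ((W.localPolynomialAt v).map (Int.castRingHom (PadicAlgCl 2))).comp (Polynomial.C ((Rat.HeightOneSpectrum.natGenerator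 v : PadicAlgCl 2)⁻¹) * (Polynomial.X + 1) ^ (PadicInt.toZModPow n (-(Literature.NumberTheory.EllipticCurves.GreenbergVatsal2000.frobeniusExponent 2 (Rat.HeightOneSpectrum.natGenerator v : ℤ_[2])))).val)) %ₘ ((Polynomial.X + 1) ^ 2 ^ n - 1)) - (((Literature.NumberTheory.EllipticCurves.mazurTateElementK g Ω 2 n).map ι * ∏ v ∈ S₀, (1 - Polynomial.C (Literature.NumberTheory.EllipticCurves.embCoeff g ι (Rat.HeightOneSpectrum.natGenerator v)) * Polynomial.X + (if Rat.HeightOneSpectrum.natGenerator v ∣ M then 0 else Polynomial.C (Rat.HeightOneSpectrum.natGenerator v : PadicAlgCl 2)) * Polynomial.X ^ 2).comp (Polynomial.C ((Rat.HeightOneSpectrum.natGenerator v : PadicAlgCl 2)⁻¹) * (Polynomial.X + 1) ^ (PadicInt.toZModPow n (-(Literature.NumberTheory.EllipticCurves.GreenbergVatsal2000.frobeniusExponent 2 (Rat.HeightOneSpectrum.natGenerator v : ℤ_[2])))).val)) %ₘ ((Polynomial.X + 1) ^ 2 ^ n - 1))).supNorm < ‖(2 : PadicAlgCl 2)‖ :=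 by
  intro W _ _ hcm hr hss ha hΔ M _ g ι Ω hodd hnew hcmg ha2 hΩ hcong _ f hf S₁ hS2 hSW hSM
  classical
  -- the minimal admissible part `S₀ = {v ∈ S₁ : v bad or ℓ_v ∣ M}`
  have hS2' : ∀ v ∈ S₁.filter (fun v ↦ ¬ W.HasGoodReductionAt v ∨ Rat.HeightOneSpectrum.natGenerator v ∣ M),
      ((2 : ℕ) : NumberField.RingOfIntegers ℚ) ∉ v.asIdeal := fun v hv ↦ hS2 v (Finset.mem_filter.mp hv).1
  have hSW' : ∀ v : IsDedekindDomain.HeightOneSpectrum (NumberField.RingOfIntegers ℚ), ¬ W.HasGoodReductionAt v →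
      v ∈ S₁.filter (fun v ↦ ¬ W.HasGoodReductionAt v ∨ Rat.HeightOneSpectrum.natGenerator v ∣ M) :=
    fun v hv ↦ Finset.mem_filter.mpr ⟨hSW v hv, Or.inl hv⟩
  have hSM' : ∀ v : IsDedekindDomain.HeightOneSpectrum (NumberField.RingOfIntegers ℚ),
      Rat.HeightOneSpectrum.natGenerator v ∣ M →
      v ∈ S₁.filter (fun v ↦ ¬ W.HasGoodReductionAt v ∨ Rat.HeightOneSpectrum.natGenerator v ∣ M) :=
    fun v hv ↦ Finset.mem_filter.mpr ⟨hSM v hv, Or.inr hv⟩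
  have hmin : ∀ v ∈ S₁.filter (fun v ↦ ¬ W.HasGoodReductionAt v ∨ Rat.HeightOneSpectrum.natGenerator v ∣ M),
      ¬ W.HasGoodReductionAt v ∨ Rat.HeightOneSpectrum.natGenerator v ∣ M := fun v hv ↦ (Finset.mem_filter.mp hv).2
  obtain ⟨n₀, hn₀⟩ := hHmin W hcm hr hss ha hΔ M g ι Ω hodd hnew hcmg ha2 hΩ hcong f hf _ hS2' hSW' hSM' hmin
  refine ⟨n₀, fun n hn he ↦ ?_⟩
  obtain ⟨a, ha'⟩ := hn₀ n hn he
  refine ⟨a, ?_⟩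
  rw [← Finset.prod_filter_mul_prod_filter_not S₁
      (fun v ↦ ¬ W.HasGoodReductionAt v ∨ Rat.HeightOneSpectrum.natGenerator v ∣ M),
    ← Finset.prod_filter_mul_prod_filter_not S₁
      (fun v ↦ ¬ W.HasGoodReductionAt v ∨ Rat.HeightOneSpectrum.natGenerator v ∣ M)]
  simp only [← mul_assoc]
  have hT : ∀ v ∈ S₁.filter (fun v ↦ ¬ (¬ W.HasGoodReductionAt v ∨ Rat.HeightOneSpectrum.natGenerator v ∣ M)),
      W.HasGoodReductionAt v ∧ ¬ Rat.HeightOneSpectrum.natGenerator v ∣ M ∧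
        ¬ 2 ∣ Rat.HeightOneSpectrum.natGenerator v := by
    intro v hv
    obtain ⟨hv1, hv2⟩ := Finset.mem_filter.mp hv
    push Not at hv2
    exact ⟨hv2.1, hv2.2, not_two_dvd_natGenerator (hS2 v hv1)⟩
  refine supNorm_congr_mul_modByMonic_lt (monic_layerModulus (p := 2) n) (supNorm_layerModulus_le_one (p := 2) n)
    (norm_pos_iff.mpr two_ne_zero) ha' (supNorm_depletedPartnerLayer_le hnew hΩ M _ hS2' n)
    (supNorm_prod_le_one _ _ fun v hv ↦ supNorm_eulerFactor_le_one (hT v hv).2.2 n) ?_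
  refine supNorm_prod_sub_prod_lt_one _ _ _ (fun v hv ↦ supNorm_eulerFactor_le_one (hT v hv).2.2 n)
    (fun v hv ↦ supNorm_partnerEulerFactor_le_one hnew ι M (hT v hv).2.2 _) fun v hv ↦ ?_
  obtain ⟨hgood, hM, h2⟩ := hT v hv
  exact supNorm_eulerFactor_sub_partnerEulerFactor_lt_one ι hgood h2 hM
    (hcong _ (Rat.HeightOneSpectrum.prime_natGenerator v) (not_dvd_two_mul_level_mul_conductor hgood h2 hM)) n

end Summit.BirchSwinnertonDyer.BirchSwinnertonDyer.Theorems.ThetaLayerLambdaCongruenceAtTwo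

end
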